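import Literature.MathematicalPhysics.QuantumLattice.HubbardOpenBoxSectorRows
import HarnessLib

/-!
# Kernel-checked exact-diagonalisation floors of open clusters, DATA-FREE: in-kernel fixed-point
# Cholesky with Kronecker-substitution dot products

Topic `MathematicalPhysics/QuantumLattice`, family `hubbard`. Second generation of the sector FLOOR
certificates of `HubbardOpenBoxEDCertificate` (`SectorCert`: a rounded `L D Lᵀ` factor SHIPPED as a
packed literal and checked entry by entry — `≈ 600 KB` of data and `≈ 10⁷` kernel steps per spin sector of
size `400`, i.e. the open `2 × 3` cluster was out of reach). Here NOTHING is shipped: for the integer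
block `A = K·(hzInt − c·1)` of the spin sector `(N↑, N↓) = (p, q)` (rows produced as big integers,
`HubbardOpenBoxSectorRows.rowA`) the kernel itself

1. computes an UNTRUSTED fixed-point Cholesky factor of `A − D·1` (`factorRows`: one pass, every dot
   product `Σ_k ℓ_ik ℓ_jk` read off as the middle digit of ONE big-integer product of packed rows —
   Kronecker substitution, Harvey 2009 §3.1 — the digits stored with an offset as in the tree's packed
   Gram certificates `PSD.Packed`; square roots by Newton iteration; no proof obligation whatsoever,
   the output is just candidate data), and then
2. CHECKS it exactly as a packed rounded Gram certificate (Blekherman–Parrilo–Thomas App. A.1.2 /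
   Rump 2006 §2): every row packing passes `PSD.Packed.peelOK`, the no-carry bound
   `n·(2O)² < X` holds, and every row of the residual `A − L̃ L̃ᵀ` — formed on the fly from the packed
   matrix row and the middle digits `PSD.Packed.wdot` — is diagonally dominant (`ddAllK`); the margin
   `D ≈ n·2O` makes the rounded residual dominant.

`KCert.check = true` therefore proves `A ⪰ 0`, i.e. `(c/Q)·‖v‖² ≤ re⟨v, H^open(TN/Q, TD/Q, UU/Q) v⟩` on the
spin sector (`KCert.sound`; symmetry of `A` is PROVED, `hzInt_code_symm`, not checked), and
`groundEnergy_ge_of_kCerts` assembles the sectors `(p, k − p)` into `σ ≤ E₀(h_{a×b}, k)`, the hypothesis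
of the Anderson cluster bounds (`ClusterLowerBound.energyDensityTT'_ge_of_boxFloors_2x3`). Cost
(measured, kernel on the check farm): `≈ n²` big-integer products per sector; the 25 + 24 sectors of
the open `2 × 3` cluster in minutes, from a certificate file of a few kilobytes (the sector code lists
and five integers per sector).

* §1 the untrusted factoriser (`isqrtN`, `roundDiv`, `FRow`, `factorInner`, `factorRows`);
* §2 the packed matrix rows as a list (`rowsA`) and the residual walk (`resRowK`, `ddAllK`), the
  certificate parameters `KCert` and **`KCert.check`**;
* §3 soundness: `wdot` is the Gram entry (`wdot_eq_sum`, via `PSD.Packed.middleDigit_eq`), a passing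
  check is an integer rounded Gram certificate `PSD.IsGramCertZ` for `A` (`isGramCertZ_of_check`),
  the complex quadratic form (`re_quadForm_nonneg_of_real`), **`KCert.sound`** and
  **`groundEnergy_ge_of_kCerts`**.

Everything is proved; no named fact; nothing numerical is asserted here.

## References

* D. Harvey, J. Symb. Comput. 44 (2009) 1502, §3.1 (Kronecker substitution). [cite: Harvey2009, §3.1]
* S. M. Rump, BIT 46 (2006) 433, §2 (rounded Cholesky + residual bound). [cite: Rump2006PosDef, §2]
* G. Blekherman, P. Parrilo, R. Thomas (eds.), SIAM 2012, App. A.1.2 (rounded Gram certificates).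
  [cite: BlekhermanParriloThomas2012, App. A.1.2]
* I. Kull, N. Schuch, B. Dive, M. Navascués, PRX 14 (2024) 021008, §5.3. [cite: KullEtAl2024, §5.3]
* H. Q. Lin, J. E. Gubernatis, Comput. Phys. 7 (1993) 400, §II. [cite: LinGubernatis1993, §II]
-/

namespace Literature.MathematicalPhysics.QuantumLattice

namespace OccupationCode

open Finset Matrix Literature.Computation.Certificates Literature.Computation.Certificates.PSD
  Literature.Computation.Certificates.PSD.Packed

/-! ### §1 The untrusted in-kernel factoriser (no proof obligations) -/

/-- Newton iteration for the integer square root (fuelled; from above it decreases to `⌊√v⌋`).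
[folklore] -/
def isqrtAux (v : ℕ) : ℕ → ℕ → ℕ
  | 0, g => g
  | fuel + 1, g =>
      let g' := (g + v / g) / 2
      if g' < g then isqrtAux v fuel g' else g

/-- Integer square root candidate (untrusted: only used to PRODUCE data that is checked afterwards).
[folklore] -/
def isqrtN (v : ℕ) : ℕ :=
  if v = 0 then 0 else isqrtAux v 96 (2 ^ (Nat.log2 v / 2 + 1))

/-- The middle digit by a shift: `(z >>> sh) % 2^x` (`sh = x·(n−1)`; `= PSD.Packed.midDigit (2^x) (2^x)^(n-1) z`,
`midDig_eq`). [cite: Harvey2009, §3.1] -/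
def midDig (x sh z : ℕ) : ℕ := (z >>> sh) % 2 ^ x

/-- The offset digit `O + round((P − M)/d)` from the two nonnegative parts `P, M` of a numerator (half away
from zero, clamped at `0`; pure `ℕ`). [folklore] -/
def digitOf (O d P M : ℕ) : ℕ :=
  if M ≤ P then O + (2 * (P - M) + d) / (2 * d) else O - (2 * (M - P) + d) / (2 * d)

/-- One factor row during the untrusted pass: its packing (`PSD.Packed.Row`: `p` little-endian,
`r` big-endian, `t` digit sum), its diagonal `ℓ_jj` and the sum of its offset digits before the
diagonal. [cite: Harvey2009, §3.1] -/
structure FRow where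
  /-- the packed row -/
  row : Row
  /-- the diagonal entry `ℓ_jj ≥ 1` -/
  diag : ℕ
  /-- `Σ_{k<j} (ℓ_jk + O)` -/
  pre : ℕ

/-- Inner loop of the fixed-point Cholesky step for row `i` (all in `ℕ`): over the previous rows
`j = 0, 1, …` the offset digit `a_ij = O + round((A_ij − Σ_{k<j} ℓ_ik ℓ_jk)/ℓ_jj)`, the dot product being the
middle digit of `R · p_j` (`R` = big-endian packing of the digits of row `i` found so far) corrected for the
offsets; the accumulators (`R`, the little-endian packing `Pacc`, the digit sum `s`, the running powers) are
forced at every step (the `0 * (…)` summand) so that no deep unevaluated chain is left to the kernel.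
[cite: Harvey2009, §3.1] -/
def factorInner (y x sh O OA : ℕ) (RA : ℕ) : List FRow → ℕ → ℕ → ℕ → ℕ → ℕ → ℕ → ℕ × ℕ × ℕ
  | [], _, R, Pacc, s, _, _ => (R, Pacc, s)
  | f :: fs, j, R, Pacc, s, xj, xr =>
      let aij := digitOf O f.diag ((RA >>> (y * j)) % 2 ^ y + O * s + O * f.pre)
        (OA + midDig x sh (R * f.row.p) + j * (O * O))
      factorInner y x sh O OA RA fs (j + 1) (R + aij * xr + 0 * (Pacc + xj)) (Pacc + aij * xj) (s + aij)
        (xj <<< x) (xr >>> x)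

/-- **The untrusted fixed-point Cholesky factoriser**: rows `i = i₀, i₀ + 1, …` of `L̃` with
`A − D·1 ≈ L̃ L̃ᵀ` (`A` given by its packed rows `RAs`, fields of `y` bits, offset `OA`), each emitted as a
full-length offset packing `⟨p, r, t⟩` (digits `ℓ + O`, digits beyond the diagonal equal to `O`), appended in
order. [cite: Rump2006PosDef, §2] [cite: Harvey2009, §3.1] -/
def factorRows (y x sh O OA D n : ℕ) : List ℕ → ℕ → List FRow → List FRow
  | [], _, prev => prev
  | RA :: RAs, i, prev =>
      let st := factorInner y x sh O OA RA prev 0 0 0 0 1 (1 <<< sh)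
      let P := (RA >>> (y * i)) % 2 ^ y + 2 * O * st.2.2
      let M := OA + D + midDig x sh (st.1 * st.2.1) + i * (O * O)
      let ℓ : ℕ := if M ≤ P then max 1 (isqrtN (P - M)) else 1
      let g : ℕ := ((1 <<< (x * (n - 1 - i))) - 1) / (2 ^ x - 1)
      let row : FRow :=
        ⟨⟨st.2.1 + ((ℓ + O) <<< (x * i)) + ((O * g) <<< (x * (i + 1))), st.1 + ((ℓ + O) <<< (x * (n - 1 - i))) + O * g,
          st.2.2 + (ℓ + O) + (n - 1 - i) * O⟩, ℓ, st.2.2⟩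
      factorRows y x sh O OA D n RAs (i + 1) (prev ++ [row])

/-! ### §2a A faster row builder (adjacency lists computed once, hop signs by parity, powers by shifts) -/

section FastRows

/-- The ordered orbital pairs `(2P + σ, 2Q + σ)` over the adjacent site pairs of a coded adjacency — computed
ONCE per certificate instead of testing all `N²` site pairs in every row. [cite: LinGubernatis1993, §II] -/
def hopOrbs (adj : ℕ → ℕ → Bool) (N : ℕ) : List (ℕ × ℕ) :=
  (List.range N).flatMap fun P => (List.range N).flatMap fun Q =>
    if adj P Q then [(2 * P, 2 * Q), (2 * P + 1, 2 * Q + 1)] else []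

/-- Hopping word application with the Jordan–Wigner sign by ONE parity test (same value as `hopApply`,
whose `(-1)^k` the kernel evaluates by `k` multiplications). [cite: LinGubernatis1993, §II] -/
def hopApplyPar (p q m : ℕ) (f : ℕ → ℤ) : ℤ :=
  if m.testBit p = true ∧ (m - 2 ^ p).testBit q = false then
    (if (bitCount (m - 2 ^ p) p + bitCount (m - 2 ^ p) q) % 2 = 0 then f (m - 2 ^ p + 2 ^ q)
      else -f (m - 2 ^ p + 2 ^ q)) else 0

/-- `hopApplyPar = hopApply`. [cite: LinGubernatis1993, §II] -/
theorem hopApplyPar_eq (p q m : ℕ) (f : ℕ → ℤ) : hopApplyPar p q m f = hopApply p q m f := by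
  unfold hopApplyPar hopApply
  split_ifs with h hpar
  · rcases Nat.even_or_odd (bitCount (m - 2 ^ p) p + bitCount (m - 2 ^ p) q) with he | ho
    · rw [he.neg_one_pow, one_mul]
    · exfalso; rw [Nat.odd_iff] at ho; omega
  · rcases Nat.even_or_odd (bitCount (m - 2 ^ p) p + bitCount (m - 2 ^ p) q) with he | ho
    · exfalso; rw [Nat.even_iff] at he; exact hpar he
    · rw [ho.neg_one_pow, neg_one_mul]
  · rfl

/-- `Σ_{(p,q) ∈ l} hopApplyPar p q m f` (structural). [cite: LinGubernatis1993, §II] -/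
def hopListSum (m : ℕ) (f : ℕ → ℤ) : List (ℕ × ℕ) → ℤ
  | [] => 0
  | pq :: rest => hopApplyPar pq.1 pq.2 m f + hopListSum m f rest

/-- `hopListSum` is the list sum. [folklore] -/
private theorem hopListSum_eq_sum (m : ℕ) (f : ℕ → ℤ) :
    ∀ l : List (ℕ × ℕ), hopListSum m f l = (l.map fun pq => hopApplyPar pq.1 pq.2 m f).sum
  | [] => rfl
  | pq :: rest => by rw [hopListSum, hopListSum_eq_sum m f rest, List.map_cons, List.sum_cons]

/-- Sum over a `flatMap`. [folklore] -/
private theorem sum_map_flatMap {α β : Type*} (l : List α) (g : α → List β) (F : β → ℤ) :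
    ((l.flatMap g).map F).sum = (l.map fun a => ((g a).map F).sum).sum := by
  induction l with
  | nil => rfl
  | cons a l ih => rw [List.flatMap_cons, List.map_append, List.sum_append, ih, List.map_cons, List.sum_cons]

/-- A list sum over `List.range N` is the `Finset.range` sum. [folklore] -/
private theorem sum_map_range (g : ℕ → ℤ) : ∀ N : ℕ, ((List.range N).map g).sum = ∑ P ∈ range N, g P
  | 0 => rfl
  | N + 1 => by
      rw [List.range_succ, List.map_append, List.sum_append, sum_map_range g N, Finset.sum_range_succ]
      simp

/-- **The adjacency-list hop sum is the coded hop application**: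
`hopListSum m f (hopOrbs adj N) = openBoxHopApply adj N m f`. [cite: LinGubernatis1993, §II] -/
theorem hopListSum_hopOrbs (adj : ℕ → ℕ → Bool) (N m : ℕ) (f : ℕ → ℤ) :
    hopListSum m f (hopOrbs adj N) = openBoxHopApply adj N m f := by
  rw [openBoxHopApply, sumNat_eq, hopListSum_eq_sum, hopOrbs, sum_map_flatMap, sum_map_range]
  refine Finset.sum_congr rfl fun P _ => ?_
  rw [sumNat_eq, sum_map_flatMap, sum_map_range]
  refine Finset.sum_congr rfl fun Q _ => ?_
  split_ifs with h
  · simp [sumNat, hopApplyPar_eq]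
  · simp

/-- `m ↦ 2^{y·rank m}` by a shift (the coded vector `powF (2^y)`). [cite: Harvey2009, §3.1] -/
def shiftF (y RT : ℕ) (m : ℕ) : ℤ := ((1 <<< (y * rankOf RT m) : ℕ) : ℤ)

/-- `shiftF y RT = powF (2^y) RT`. [cite: Harvey2009, §3.1] -/
theorem shiftF_eq (y RT : ℕ) : shiftF y RT = powF (2 ^ y) RT := by
  funext m
  rw [shiftF, powF, Nat.one_shiftLeft, pow_mul]

/-- The fast packed row (adjacency lists, parity signs, shifts). [cite: LinGubernatis1993, §II] -/
def rowHFast (a b : ℕ) (TN TD UU : ℤ) (y RT m : ℕ) : ℤ :=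
  -TN * hopListSum m (shiftF y RT) (hopOrbs (nnAdjCode b) (a * b))
    - TD * hopListSum m (shiftF y RT) (hopOrbs (diagAdjCode b) (a * b))
    + UU * (doccOf (a * b) m * shiftF y RT m)

/-- `rowHFast = rowH` at `Y = 2^y`. [cite: LinGubernatis1993, §II] -/
theorem rowHFast_eq (a b : ℕ) (TN TD UU : ℤ) (y RT m : ℕ) :
    rowHFast a b TN TD UU y RT m = rowH a b TN TD UU (2 ^ y) RT m := by
  rw [rowHFast, rowH, shiftF_eq, hopListSum_hopOrbs, hopListSum_hopOrbs]

/-- The fast offset packed row (as `rowA`, built from `rowHFast`). [cite: Harvey2009, §3.1] -/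
def rowAFast (a b : ℕ) (TN TD UU : ℤ) (K : ℕ) (c : ℤ) (y O G RT m i : ℕ) : ℕ :=
  ((K : ℤ) * rowHFast a b TN TD UU y RT m - (K : ℤ) * c * (((1 <<< (y * i) : ℕ) : ℤ)) + (O : ℤ) * (G : ℤ)).toNat

/-- `rowAFast = rowA` at `Y = 2^y`. [cite: Harvey2009, §3.1] -/
theorem rowAFast_eq (a b : ℕ) (TN TD UU : ℤ) (K : ℕ) (c : ℤ) (y O G RT m i : ℕ) :
    rowAFast a b TN TD UU K c y O G RT m i = rowA a b TN TD UU K c (2 ^ y) O G RT m i := by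
  rw [rowAFast, rowA, rowHFast_eq, Nat.one_shiftLeft, pow_mul]
  push_cast
  rfl

/-- The fast packed matrix rows along the code list (positions from `i₀`). [cite: LinGubernatis1993, §II] -/
def rowsAFast (a b : ℕ) (TN TD UU : ℤ) (K : ℕ) (c : ℤ) (y O G RT : ℕ) : List ℕ → ℕ → List ℕ
  | [], _ => []
  | m :: rest, i => rowAFast a b TN TD UU K c y O G RT m i :: rowsAFast a b TN TD UU K c y O G RT rest (i + 1)

end FastRows

/-! ### §2 The checker -/

section Checker

/-- The packed matrix rows `rowA … m i` along the code list (positions from `i₀`).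
[cite: LinGubernatis1993, §II] -/
def rowsA (a b : ℕ) (TN TD UU : ℤ) (K : ℕ) (c : ℤ) (Y OA G RT : ℕ) : List ℕ → ℕ → List ℕ
  | [], _ => []
  | m :: rest, i => rowA a b TN TD UU K c Y OA G RT m i :: rowsA a b TN TD UU K c Y OA G RT rest (i + 1)

/-- `rowsAFast = rowsA` at `Y = 2^y`. [cite: LinGubernatis1993, §II] -/
theorem rowsAFast_eq (a b : ℕ) (TN TD UU : ℤ) (K : ℕ) (c : ℤ) (y O G RT : ℕ) :
    ∀ (L : List ℕ) (i : ℕ), rowsAFast a b TN TD UU K c y O G RT L i = rowsA a b TN TD UU K c (2 ^ y) O G RT L i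
  | [], _ => rfl
  | m :: rest, i => by rw [rowsAFast, rowsA, rowAFast_eq, rowsAFast_eq a b TN TD UU K c y O G RT rest (i + 1)]

/-- `|P − M|` on naturals. [folklore] -/
def absDiff (P M : ℕ) : ℕ := if M ≤ P then P - M else M - P

/-- The walk along the factor rows for residual row `i`: accumulate `Σ_j |E_ij|`, each entry from its two
nonnegative parts (matrix field + `O(t_i + t_j)` against offset + middle digit + `O² n`), failing as soon as
the budget `D2 = 2 E_ii` is exceeded (which also forces the accumulator at every step).
[cite: BlekhermanParriloThomas2012, App. A.1.2] -/
def rowLoop (y x sh O OA n : ℕ) (RA : ℕ) (qi : Row) (D2 : ℕ) : List Row → ℕ → ℕ → Bool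
  | [], _, acc => decide (acc ≤ D2)
  | qj :: qs, j, acc =>
      let acc' := acc + absDiff ((RA >>> (y * j)) % 2 ^ y + O * (qi.t + qj.t)) (OA + midDig x sh (qi.p * qj.r) + O * O * n)
      !(decide (D2 < acc')) && rowLoop y x sh O OA n RA qi D2 qs (j + 1) acc'

/-- Diagonal dominance of residual row `i`: `E_ii ≥ 0` and `Σ_j |E_ij| ≤ 2 E_ii`.
[cite: BlekhermanParriloThomas2012, App. A.1.2] -/
def rowOK (y x sh O OA n : ℕ) (RA : ℕ) (qi : Row) (i : ℕ) (P : List Row) : Bool :=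
  let Pd := (RA >>> (y * i)) % 2 ^ y + O * (qi.t + qi.t)
  let Md := OA + midDig x sh (qi.p * qi.r) + O * O * n
  decide (Md ≤ Pd) && rowLoop y x sh O OA n RA qi (2 * (Pd - Md)) P 0 0

/-- Diagonal dominance of all residual rows, walking the packed matrix rows and the factor rows together
(`P` is the full factor). [cite: BlekhermanParriloThomas2012, App. A.1.2] -/
def ddAllN (y x sh O OA n : ℕ) (P : List Row) : ℕ → List ℕ → List Row → Bool
  | _, [], _ => true
  | _, _ :: _, [] => true
  | i, RA :: RAs, qi :: qs => rowOK y x sh O OA n RA qi i P && ddAllN y x sh O OA n P (i + 1) RAs qs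

end Checker

/-- **Parameters of a data-free sector certificate**: the integer scale `K` of the block, the shift `c`
(the certified floor is `c/Q`), the diagonal margin `D` handed to the factoriser, the digit width `x`
and offset `O` of the factor packings, and the field width `y` of the packed matrix rows.
[cite: Rump2006PosDef, §2] -/
structure KCert where
  /-- scale of the integer block `A = K·(hzInt − c·1)` -/
  K : ℕ
  /-- shift (energy units `1/Q`) -/
  c : ℤ
  /-- diagonal margin for the factoriser -/
  D : ℕ
  /-- digit bits of the factor packings -/
  x : ℕ
  /-- digit offset of the factor packings -/
  O : ℕ
  /-- field bits of the packed matrix rows -/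
  y : ℕ

namespace KCert

variable (C : KCert)

/-- The factor rows computed by the kernel for the sector code list `L` (untrusted data).
[cite: Rump2006PosDef, §2] -/
def factorOf (a b : ℕ) (TN TD UU : ℤ) (L : List ℕ) : List Row :=
  let n := L.length
  let RAs := rowsAFast a b TN TD UU C.K C.c C.y (2 ^ (C.y - 1)) (geomNat (2 ^ C.y) n) (rankTab L 0) L 0
  (factorRows C.y C.x (C.x * (n - 1)) C.O (2 ^ (C.y - 1)) C.D n RAs 0 []).map FRow.row

/-- **THE KERNEL CHECKER** of a data-free certificate for the spin sector `(p, q)` of the open `a × b`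
cluster with couplings `(TN/Q, TD/Q, UU/Q)` and supplied code list `L`: the list enumerates the sector
(`sectorListOK`) and its rank table is right, the packed-row fields cannot carry, the factor computed
by the kernel passes the packed rounded Gram check (peel, no-carry bound, diagonal dominance of every
residual row). Discharge by `decide +kernel`. [cite: BlekhermanParriloThomas2012, App. A.1.2] [cite: Rump2006PosDef, §2] -/
def check (a b p q : ℕ) (TN TD UU : ℤ) (Q : ℕ) (L : List ℕ) : Bool :=
  let n := L.length
  let X := 2 ^ C.x
  let OA := 2 ^ (C.y - 1)
  let RT := rankTab L 0
  let RAs := rowsAFast a b TN TD UU C.K C.c C.y OA (geomNat (2 ^ C.y) n) RT L 0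
  let P := C.factorOf a b TN TD UU L
  decide (0 < Q) && decide (0 < C.K) && decide (1 ≤ C.y) && sectorListOK a b p q L && rankOK RT L 0 &&
    decide (C.K * (hzBound (a * b) TN TD UU + C.c.natAbs) < OA) &&
    (P.length == n) && P.all (fun r => peelOK X (2 * C.O) (List.replicate n 1) r.p 0 0 r.r r.t) &&
    decide (n * (2 * C.O) ^ 2 < X) &&
    ddAllN C.y C.x (C.x * (n - 1)) C.O OA n P 0 RAs P

/-- **The certified floor** `c/Q`. [cite: KullEtAl2024, §5.3] -/
def floor (Q : ℕ) : ℚ := (C.c : ℚ) / (Q : ℚ)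

end KCert

/-! ### §3 Soundness -/

section Sound

variable {a b : ℕ}

/-- `getD` on a list of ones. [folklore] -/
private theorem getD_replicate_one {n k : ℕ} (hk : k < n) : (List.replicate n 1).getD k 0 = 1 := by
  rw [List.getD_eq_getElem?_getD, List.getElem?_replicate, if_pos hk]
  rfl

/-- **The middle digit is the Gram entry**: for two full-length offset packings passing the peel test
under the no-carry bound `n·(2O)² < X`, `wdot X X^(n-1) O n qi qj = Σ_{k<n} (a_ik − O)(a_jk − O)`.
[cite: Harvey2009, §3.1] -/
theorem wdot_eq_sum {x O n : ℕ} {qi qj : Row}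
    (hi : peelOK (2 ^ x) (2 * O) (List.replicate n 1) qi.p 0 0 qi.r qi.t = true)
    (hj : peelOK (2 ^ x) (2 * O) (List.replicate n 1) qj.p 0 0 qj.r qj.t = true)
    (hbound : n * (2 * O) ^ 2 < 2 ^ x) :
    wdot (2 ^ x) ((2 ^ x) ^ (n - 1)) O n qi qj =
      ∑ k ∈ range n, ((((dig (2 ^ x) qi.p k : ℕ) : ℤ) - O) * (((dig (2 ^ x) qj.p k : ℕ) : ℤ) - O)) := by
  have hX : 0 < 2 ^ x := Nat.two_pow_pos x
  obtain ⟨hdi, hpi, _, hti⟩ := peelOK_spec hX (List.replicate n 1) qi.p 0 0 qi.r qi.t hi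
  obtain ⟨hdj, _, hrj, htj⟩ := peelOK_spec hX (List.replicate n 1) qj.p 0 0 qj.r qj.t hj
  simp only [zero_mul, zero_add, List.length_replicate] at hrj hti htj hdi hdj hpi
  have hrj' : qj.r = ∑ k ∈ range n, 1 * dig (2 ^ x) qj.p k * (2 ^ x) ^ (n - 1 - k) := by
    rw [hrj]; exact Finset.sum_congr rfl fun k hk => by rw [getD_replicate_one (Finset.mem_range.1 hk)]
  have hti' : qi.t = ∑ k ∈ range n, dig (2 ^ x) qi.p k := by
    rw [hti]; exact Finset.sum_congr rfl fun k hk => by rw [getD_replicate_one (Finset.mem_range.1 hk), one_mul]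
  have htj' : qj.t = ∑ k ∈ range n, dig (2 ^ x) qj.p k := by
    rw [htj]; exact Finset.sum_congr rfl fun k hk => by rw [getD_replicate_one (Finset.mem_range.1 hk), one_mul]
  -- the middle digit
  have hmid : midDigit (2 ^ x) ((2 ^ x) ^ (n - 1)) (qi.p * qj.r) =
      ∑ k ∈ range n, dig (2 ^ x) qi.p k * (1 * dig (2 ^ x) qj.p k) := by
    have key := middleDigit_eq hX (fun k => dig (2 ^ x) qi.p k) (fun l => 1 * dig (2 ^ x) qj.p l)
      (m := n) (amax := 2 * O - 1) (bmax := 2 * O - 1) ?_ ?_ ?_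
    · rw [sum_dig_mul_pow hX n qi.p hpi, ← hrj'] at key
      exact key
    · intro k hk; have := hdi k hk; omega
    · intro l hl; have := hdj l hl; omega
    · calc n * (2 * O - 1) * (2 * O - 1) = n * ((2 * O - 1) * (2 * O - 1)) := by ring
        _ ≤ n * (2 * O) ^ 2 := by
            apply Nat.mul_le_mul_left
            rw [sq]
            exact Nat.mul_le_mul (Nat.sub_le _ _) (Nat.sub_le _ _)
        _ < 2 ^ x := hbound
  unfold wdot
  rw [hmid, hti', htj']
  push_cast
  simp only [one_mul, mul_add, Finset.mul_sum, ← Finset.sum_add_distrib, ← Finset.sum_sub_distrib]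
  rw [show ((O : ℤ) * O * n : ℤ) = ∑ k ∈ range n, (O : ℤ) * O by
    rw [Finset.sum_const, Finset.card_range]; simp [mul_comm]]
  rw [← Finset.sum_add_distrib]
  exact Finset.sum_congr rfl fun k _ => by ring

/-- Length of the packed-row list. [folklore] -/
private theorem length_rowsA (TN TD UU : ℤ) (K : ℕ) (c : ℤ) (Y OA G RT : ℕ) :
    ∀ (L : List ℕ) (i : ℕ), (rowsA a b TN TD UU K c Y OA G RT L i).length = L.length
  | [], _ => rfl
  | m :: rest, i => by simp [rowsA, length_rowsA TN TD UU K c Y OA G RT rest (i + 1)]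

/-- Entries of the packed-row list. [folklore] -/
private theorem getD_rowsA (TN TD UU : ℤ) (K : ℕ) (c : ℤ) (Y OA G RT : ℕ) :
    ∀ (L : List ℕ) (i₀ k : ℕ) (hk : k < L.length),
      (rowsA a b TN TD UU K c Y OA G RT L i₀).getD k 0 = rowA a b TN TD UU K c Y OA G RT L[k] (i₀ + k)
  | [], _, k, hk => absurd hk (Nat.not_lt_zero k)
  | m :: rest, i₀, 0, _ => by simp [rowsA]
  | m :: rest, i₀, k + 1, hk => by
      simp only [rowsA, List.getD_cons_succ, List.getElem_cons_succ]
      rw [getD_rowsA TN TD UU K c Y OA G RT rest (i₀ + 1) k (by simpa using hk)]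
      simp only [add_assoc, add_comm 1 k]

/-- `midDig` is the middle digit `PSD.Packed.midDigit` at `X = 2^x`. [cite: Harvey2009, §3.1] -/
theorem midDig_eq (x k z : ℕ) : midDig x (x * k) z = midDigit (2 ^ x) ((2 ^ x) ^ k) z := by
  rw [midDig, midDigit, Nat.shiftRight_eq_div_pow, pow_mul]

/-- `|P − M|` as the `natAbs` of the integer difference. [folklore] -/
private theorem natAbs_sub_cast (P M : ℕ) : ((P : ℤ) - (M : ℤ)).natAbs = absDiff P M := by
  unfold absDiff
  split_ifs with h
  · rw [← Nat.cast_sub h, Int.natAbs_natCast]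
  · rw [show (P : ℤ) - M = -((M : ℤ) - P) by ring, Int.natAbs_neg, ← Nat.cast_sub (le_of_not_ge h),
      Int.natAbs_natCast]

/-- The residual entry from its two nonnegative parts: matrix field + `O(t_i + t_j)` against offset + middle
digit + `O² n`. [cite: BlekhermanParriloThomas2012, App. A.1.2] -/
private theorem entry_sub_wdot (y x n O RA j : ℕ) (qi qj : Row) :
    entry y RA j - wdot (2 ^ x) ((2 ^ x) ^ (n - 1)) O n qi qj =
      (((RA >>> (y * j)) % 2 ^ y + O * (qi.t + qj.t) : ℕ) : ℤ) -
        ((2 ^ (y - 1) + midDig x (x * (n - 1)) (qi.p * qj.r) + O * O * n : ℕ) : ℤ) := by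
  rw [entry, wdot, ← midDig_eq]
  push_cast
  ring

/-- Semantics of `rowLoop`: on success the accumulated absolute row sum stays within the budget. [folklore] -/
private theorem rowLoop_spec (y x sh O OA n RA : ℕ) (qi : Row) (D2 : ℕ) :
    ∀ (qs : List Row) (j acc : ℕ), rowLoop y x sh O OA n RA qi D2 qs j acc = true →
      acc + ∑ k ∈ range qs.length, absDiff ((RA >>> (y * (j + k))) % 2 ^ y + O * (qi.t + (qs.getD k ⟨0, 0, 0⟩).t))
        (OA + midDig x sh (qi.p * (qs.getD k ⟨0, 0, 0⟩).r) + O * O * n) ≤ D2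
  | [], j, acc, h => by
      rw [rowLoop, decide_eq_true_eq] at h
      rw [List.length_nil, Finset.sum_range_zero, add_zero]
      exact h
  | qj :: qs, j, acc, h => by
      rw [rowLoop, Bool.and_eq_true, Bool.not_eq_eq_eq_not, Bool.not_true, decide_eq_false_iff_not,
        not_lt] at h
      obtain ⟨_, h2⟩ := h
      have ih := rowLoop_spec y x sh O OA n RA qi D2 qs (j + 1) _ h2
      rw [List.length_cons, Finset.sum_range_succ']
      simp only [List.getD_cons_zero, List.getD_cons_succ, add_zero]
      rw [Finset.sum_congr rfl fun k _ => by rw [show j + (k + 1) = j + 1 + k by omega]]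
      linarith

/-- Semantics of `rowOK`: the diagonal parts are ordered and the whole absolute row sum is at most twice the
diagonal entry. [folklore] -/
private theorem rowOK_spec {y x sh O OA n RA i : ℕ} {qi : Row} {P : List Row}
    (h : rowOK y x sh O OA n RA qi i P = true) :
    OA + midDig x sh (qi.p * qi.r) + O * O * n ≤ (RA >>> (y * i)) % 2 ^ y + O * (qi.t + qi.t) ∧
    ∑ k ∈ range P.length, absDiff ((RA >>> (y * k)) % 2 ^ y + O * (qi.t + (P.getD k ⟨0, 0, 0⟩).t))
        (OA + midDig x sh (qi.p * (P.getD k ⟨0, 0, 0⟩).r) + O * O * n) ≤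
      2 * ((RA >>> (y * i)) % 2 ^ y + O * (qi.t + qi.t) - (OA + midDig x sh (qi.p * qi.r) + O * O * n)) := by
  simp only [rowOK, Bool.and_eq_true, decide_eq_true_eq] at h
  refine ⟨h.1, ?_⟩
  have := rowLoop_spec y x sh O OA n RA qi _ P 0 0 h.2
  simpa using this

/-- Semantics of `ddAllN`: every row from `i₀` on passes `rowOK`. [folklore] -/
private theorem ddAllN_spec (y x sh O OA n : ℕ) (P : List Row) :
    ∀ (i₀ : ℕ) (RAs : List ℕ) (qs : List Row), RAs.length = qs.length → ddAllN y x sh O OA n P i₀ RAs qs = true →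
      ∀ k < qs.length, rowOK y x sh O OA n (RAs.getD k 0) (qs.getD k ⟨0, 0, 0⟩) (i₀ + k) P = true
  | _, [], [], _, _, k, hk => by simp at hk
  | _, [], _ :: _, hl, _, _, _ => by simp at hl
  | _, _ :: _, [], hl, _, _, _ => by simp at hl
  | i₀, RA :: RAs, qi :: qs, hl, h, k, hk => by
      simp only [ddAllN, Bool.and_eq_true] at h
      cases k with
      | zero => simpa using h.1
      | succ k =>
          have := ddAllN_spec y x sh O OA n P (i₀ + 1) RAs qs (by simpa using hl) h.2 k (by simpa using hk)
          simpa [add_assoc, add_comm 1 k] using this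

/-- The integer block of the spin sector along the code list `L`: `A i j = K·(hzInt L[i] L[j] − c·δ_ij)`.
[cite: LinGubernatis1993, §II] -/
def blockA (a b : ℕ) (TN TD UU : ℤ) (K : ℕ) (c : ℤ) (L : List ℕ) : Matrix (Fin L.length) (Fin L.length) ℤ :=
  fun i j => (K : ℤ) * (hzInt a b TN TD UU L[i] L[j] - if i = j then c else 0)

/-- **Soundness (reduction)**: a passing data-free check is an integer rounded Gram certificate
`PSD.IsGramCertZ` for the block `A = K·(hzInt − c·1)` along `L`, the unit weights and the factor decoded
from the kernel-computed packings. [cite: BlekhermanParriloThomas2012, App. A.1.2] [cite: Rump2006PosDef, §2] -/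
theorem isGramCertZ_of_check (C : KCert) {p q : ℕ} {TN TD UU : ℤ} {Q : ℕ} {L : List ℕ}
    (h : C.check a b p q TN TD UU Q L = true) :
    IsGramCertZ (blockA a b TN TD UU C.K C.c L) (weights (List.replicate L.length 1))
      (factor C.x C.O (List.replicate L.length 1) (C.factorOf a b TN TD UU L) L.length) := by
  have hX : 0 < 2 ^ C.x := Nat.two_pow_pos C.x
  simp only [KCert.check, Bool.and_eq_true, decide_eq_true_eq, beq_iff_eq, List.all_eq_true] at h
  obtain ⟨⟨⟨⟨⟨⟨⟨⟨⟨_, _⟩, hy⟩, hL⟩, hRT⟩, hKO⟩, hlen⟩, hpeel⟩, hbound⟩, hdd⟩ := h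
  set n := L.length with hn
  set P := C.factorOf a b TN TD UU L with hP
  rw [rowsAFast_eq] at hdd
  set RAs := rowsA a b TN TD UU C.K C.c (2 ^ C.y) (2 ^ (C.y - 1)) (geomNat (2 ^ C.y) L.length) (rankTab L 0) L 0
    with hRAs
  have hpeel' : ∀ i < n, peelOK (2 ^ C.x) (2 * C.O) (List.replicate n 1) (rowOf P i).p 0 0 (rowOf P i).r
      (rowOf P i).t = true := by
    intro i hi
    have hmem : rowOf P i ∈ P := by
      simp only [rowOf, List.getD_eq_getElem?_getD]
      rw [List.getElem?_eq_getElem (by omega)]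
      exact List.getElem_mem _
    exact hpeel _ hmem
  -- the matrix entries read from the packed rows
  have hRA : ∀ i : Fin L.length, RAs.getD i 0 =
      rowA a b TN TD UU C.K C.c (2 ^ C.y) (2 ^ (C.y - 1)) (geomNat (2 ^ C.y) L.length) (rankTab L 0) L[i] i := by
    intro i
    rw [hRAs, getD_rowsA TN TD UU C.K C.c _ _ _ _ L 0 i i.isLt, zero_add]
    simp only [Fin.getElem_fin]
  have hentry : ∀ i j : Fin L.length, entry C.y (RAs.getD i 0) j = blockA a b TN TD UU C.K C.c L i j := by
    intro i j
    rw [hRA i, entry_rowA hL TN TD UU hy hRT hKO i j]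
    rfl
  -- the residual entries
  have hres : ∀ i j : Fin L.length,
      gramResidualZ (blockA a b TN TD UU C.K C.c L) (weights (List.replicate n 1))
        (factor C.x C.O (List.replicate n 1) P n) i j =
      entry C.y (RAs.getD i 0) j - wdot (2 ^ C.x) ((2 ^ C.x) ^ (n - 1)) C.O n (rowOf P i) (rowOf P j) := by
    intro i j
    rw [wdot_eq_sum (hpeel' i i.isLt) (hpeel' j j.isLt) hbound, hentry, gramResidualZ]
    congr 1
    have hw : ∀ k : Fin (List.replicate n 1).length, (weights (List.replicate n 1) k : ℤ) = 1 := by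
      intro k
      rw [weights, getD_replicate_one (by simpa using k.isLt)]
      rfl
    simp only [hw, one_mul, factor]
    rw [Fin.sum_univ_eq_sum_range (fun k => ((((dig (2 ^ C.x) (rowOf P i).p k : ℕ) : ℤ) - C.O) *
      (((dig (2 ^ C.x) (rowOf P j).p k : ℕ) : ℤ) - C.O))) (List.replicate n 1).length, List.length_replicate]
  refine IsDiagDominantZ.intro (fun i j => ?_) (fun i => ?_)
  · -- symmetry (proved, not checked)
    simp only [gramResidualZ, blockA]
    have hij : hzInt a b TN TD UU L[i] L[j] = hzInt a b TN TD UU L[j] L[i] := by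
      have hci : code (decode L[i] : Finset (Orb (Fin a ×ₗ Fin b))) = L[i] :=
        code_decode (lt_of_mem_of_ok hL (List.getElem_mem i.isLt))
      have hcj : code (decode L[j] : Finset (Orb (Fin a ×ₗ Fin b))) = L[j] :=
        code_decode (lt_of_mem_of_ok hL (List.getElem_mem j.isLt))
      have := hzInt_code_symm (a := a) (b := b) TN TD UU (decode L[i]) (decode L[j])
      rwa [hci, hcj] at this
    rw [hij]
    by_cases hij' : i = j
    · subst hij'; rfl
    · rw [if_neg hij', if_neg (Ne.symm hij')]
      congr 1
      exact Finset.sum_congr rfl fun k _ => by ring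
  · -- row `i` diagonal dominance
    set M := gramResidualZ (blockA a b TN TD UU C.K C.c L) (weights (List.replicate n 1))
      (factor C.x C.O (List.replicate n 1) P n) with hM
    have hlenRA : RAs.length = P.length := by rw [hRAs, length_rowsA, hlen]
    have hrow := ddAllN_spec C.y C.x (C.x * (n - 1)) C.O (2 ^ (C.y - 1)) n P 0 RAs P hlenRA hdd i (by omega)
    simp only [zero_add] at hrow
    obtain ⟨hdiag, hsum⟩ := rowOK_spec hrow
    rw [hlen] at hsum
    -- the entries of `M` in two-part form
    have hMij : ∀ j : Fin L.length, M i j =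
        (((RAs.getD i 0 >>> (C.y * (j : ℕ))) % 2 ^ C.y + C.O * ((rowOf P i).t + (rowOf P j).t) : ℕ) : ℤ) -
          ((2 ^ (C.y - 1) + midDig C.x (C.x * (n - 1)) ((rowOf P i).p * (rowOf P j).r) + C.O * C.O * n : ℕ) : ℤ) := by
      intro j
      rw [hres i j, entry_sub_wdot]
    have hMabs : ∀ j : Fin L.length, |M i j| =
        (absDiff ((RAs.getD i 0 >>> (C.y * (j : ℕ))) % 2 ^ C.y + C.O * ((rowOf P i).t + (rowOf P j).t))
          (2 ^ (C.y - 1) + midDig C.x (C.x * (n - 1)) ((rowOf P i).p * (rowOf P j).r) + C.O * C.O * n) : ℤ) := by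
      intro j
      rw [← Int.natCast_natAbs, hMij, natAbs_sub_cast]
    have hdiagR : 2 ^ (C.y - 1) + midDig C.x (C.x * (n - 1)) ((rowOf P i).p * (rowOf P i).r) + C.O * C.O * n ≤
        (RAs.getD i 0 >>> (C.y * (i : ℕ))) % 2 ^ C.y + C.O * ((rowOf P i).t + (rowOf P i).t) := hdiag
    have hdiag' : ((2 ^ (C.y - 1) + midDig C.x (C.x * (n - 1)) ((rowOf P i).p * (rowOf P i).r) + C.O * C.O * n : ℕ) : ℤ) ≤
        (((RAs.getD i 0 >>> (C.y * (i : ℕ))) % 2 ^ C.y + C.O * ((rowOf P i).t + (rowOf P i).t) : ℕ) : ℤ) := by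
      exact_mod_cast hdiagR
    have h2 : 0 ≤ M i i := by rw [hMij i]; linarith
    -- `Σ_j |M i j| ≤ 2 M i i`
    have hsum' : ((∑ k ∈ range n, absDiff ((RAs.getD i 0 >>> (C.y * k)) % 2 ^ C.y + C.O * ((rowOf P i).t + (rowOf P k).t))
        (2 ^ (C.y - 1) + midDig C.x (C.x * (n - 1)) ((rowOf P i).p * (rowOf P k).r) + C.O * C.O * n) : ℕ) : ℤ) ≤
        ((2 * ((RAs.getD i 0 >>> (C.y * (i : ℕ))) % 2 ^ C.y + C.O * ((rowOf P i).t + (rowOf P i).t) -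
          (2 ^ (C.y - 1) + midDig C.x (C.x * (n - 1)) ((rowOf P i).p * (rowOf P i).r) + C.O * C.O * n)) : ℕ) : ℤ) := by
      exact_mod_cast hsum
    have h1 : ∑ j : Fin n, |M i j| ≤ 2 * M i i := by
      rw [Finset.sum_congr rfl fun j _ => hMabs j,
        ← Finset.sum_range (fun k => (absDiff ((RAs.getD i 0 >>> (C.y * k)) % 2 ^ C.y + C.O * ((rowOf P i).t + (rowOf P k).t))
          (2 ^ (C.y - 1) + midDig C.x (C.x * (n - 1)) ((rowOf P i).p * (rowOf P k).r) + C.O * C.O * n) : ℤ)),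
        hMij i]
      rw [Nat.cast_sum, Nat.cast_mul, Nat.cast_sub hdiagR, Nat.cast_ofNat] at hsum'
      exact hsum'
    rw [Finset.sum_erase_eq_sub (Finset.mem_univ i), abs_of_nonneg h2]
    linarith

/-- **The complex quadratic form of a real-PSD integer matrix**: if `Σ_{ij} x_i M_ij x_j ≥ 0` for all REAL
vectors, then `re Σ_{ij} conj(w_i) M_ij w_j ≥ 0` for all complex vectors (real and imaginary parts
separate). [cite: BlekhermanParriloThomas2012, App. A.1.2] -/
theorem re_quadForm_nonneg_of_real {n : ℕ} (M : Matrix (Fin n) (Fin n) ℤ)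
    (hM : ∀ x : Fin n → ℝ, 0 ≤ ∑ i, ∑ j, x i * (M i j : ℝ) * x j) (w : Fin n → ℂ) :
    0 ≤ (∑ i, ∑ j, (starRingEnd ℂ) (w i) * (M i j : ℂ) * w j).re := by
  have hre : (∑ i, ∑ j, (starRingEnd ℂ) (w i) * (M i j : ℂ) * w j).re =
      (∑ i, ∑ j, (w i).re * (M i j : ℝ) * (w j).re) + ∑ i, ∑ j, (w i).im * (M i j : ℝ) * (w j).im := by
    rw [Complex.re_sum, ← Finset.sum_add_distrib]
    refine Finset.sum_congr rfl fun i _ => ?_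
    rw [Complex.re_sum, ← Finset.sum_add_distrib]
    refine Finset.sum_congr rfl fun j _ => ?_
    simp only [Complex.mul_re, Complex.mul_im, Complex.conj_re, Complex.conj_im, Complex.intCast_re,
      Complex.intCast_im, mul_zero, sub_zero]
    ring
  rw [hre]
  exact add_nonneg (hM _) (hM _)

namespace KCert

variable (C : KCert) {p q : ℕ} {TN TD UU : ℤ} {Q : ℕ} {L : List ℕ}

/-- **SOUNDNESS of the data-free kernel checker.** If `C.check a b p q TN TD UU Q L = true`, then for every
Fock vector `v` supported in the spin sector `(N↑, N↓) = (p, q)` of the open `a × b` cluster,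
`(c/Q) · ‖v‖² ≤ re ⟨v, H^open_{a×b}(TN/Q, TD/Q, UU/Q) v⟩`. [cite: KullEtAl2024, §5.3] [cite: Rump2006PosDef, §2] -/
theorem sound (h : C.check a b p q TN TD UU Q L = true) (v : Fock (Orb (Fin a ×ₗ Fin b)))
    (hv : ∀ s, ¬((upPart s).card = p ∧ (downPart s).card = q) → v s = 0) :
    ((C.floor Q : ℚ) : ℝ) * (star v ⬝ᵥ v).re ≤
      (star v ⬝ᵥ (hubbardOpenBoxTT' a b ((TN : ℝ) / Q) ((TD : ℝ) / Q) ((UU : ℝ) / Q) *ᵥ v)).re := by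
  have hG := isGramCertZ_of_check (a := a) (b := b) C h
  simp only [check, Bool.and_eq_true, decide_eq_true_eq, beq_iff_eq, List.all_eq_true] at h
  obtain ⟨⟨⟨⟨⟨⟨⟨⟨⟨hQ, hK⟩, _⟩, hL⟩, _⟩, _⟩, _⟩, _⟩, _⟩, _⟩ := h
  set n := L.length with hn
  let w : Fin n → ℂ := fun i => v (decode L[i])
  -- the quadratic form of the integer block is nonnegative on `w`
  have hA : 0 ≤ (∑ i, ∑ j, (starRingEnd ℂ) (w i) * (blockA a b TN TD UU C.K C.c L i j : ℂ) * w j).re :=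
    re_quadForm_nonneg_of_real _ (fun x => hG.quadForm_nonneg x) w
  -- the norm
  have hvv : star v ⬝ᵥ v = ∑ i : Fin n, (starRingEnd ℂ) (w i) * w i := by
    rw [dotProduct, ← Finset.sum_subset (Finset.subset_univ (sectorConfigs a b p q))
      (fun s _ hs => by rw [hv s (fun h => hs (mem_sectorConfigs.2 h)), mul_zero])]
    rw [sum_sectorConfigs_eq_sum_fin_of_ok hL]
    rfl
  have hvv_re : (star v ⬝ᵥ v).re = ∑ i : Fin n, ‖w i‖ ^ 2 := by
    rw [hvv, Complex.re_sum]
    refine Finset.sum_congr rfl fun i _ => ?_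
    rw [mul_comm, Complex.mul_conj, Complex.normSq_eq_norm_sq]
    norm_cast
  -- the quadratic form of `H`
  have hvHv : star v ⬝ᵥ (hubbardOpenBoxTT' a b ((TN : ℝ) / Q) ((TD : ℝ) / Q) ((UU : ℝ) / Q) *ᵥ v) =
      (∑ i : Fin n, ∑ j : Fin n, (starRingEnd ℂ) (w i) * (hzInt a b TN TD UU L[i] L[j] : ℂ) * w j) /
        ((Q : ℝ) : ℂ) := by
    rw [dotProduct, ← Finset.sum_subset (Finset.subset_univ (sectorConfigs a b p q))
      (fun s _ hs => by rw [Pi.star_apply, hv s (fun h => hs (mem_sectorConfigs.2 h)), star_zero, zero_mul])]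
    rw [sum_sectorConfigs_eq_sum_fin_of_ok hL, Finset.sum_div]
    refine Finset.sum_congr rfl fun i _ => ?_
    rw [mulVec, dotProduct, ← Finset.sum_subset (Finset.subset_univ (sectorConfigs a b p q))
      (fun s _ hs => by rw [hv s (fun h => hs (mem_sectorConfigs.2 h)), mul_zero])]
    rw [sum_sectorConfigs_eq_sum_fin_of_ok hL, Pi.star_apply, Finset.mul_sum, Finset.sum_div]
    refine Finset.sum_congr rfl fun j _ => ?_
    have hci : code (decode L[i] : Finset (Orb (Fin a ×ₗ Fin b))) = L[i] :=
      code_decode (lt_of_mem_of_ok hL (List.getElem_mem i.isLt))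
    have hcj : code (decode L[j] : Finset (Orb (Fin a ×ₗ Fin b))) = L[j] :=
      code_decode (lt_of_mem_of_ok hL (List.getElem_mem j.isLt))
    rw [hubbardOpenBoxTT'_apply_eq_hzInt_div TN TD UU hQ, hci, hcj, Complex.ofReal_intCast, RCLike.star_def]
    ring
  have hQpos : (0 : ℝ) < (Q : ℝ) := by exact_mod_cast hQ
  have hvHv_re : (star v ⬝ᵥ (hubbardOpenBoxTT' a b ((TN : ℝ) / Q) ((TD : ℝ) / Q) ((UU : ℝ) / Q) *ᵥ v)).re =
      (∑ i : Fin n, ∑ j : Fin n, (starRingEnd ℂ) (w i) * (hzInt a b TN TD UU L[i] L[j] : ℂ) * w j).re / (Q : ℝ) := by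
    rw [hvHv, Complex.div_ofReal_re]
  -- expand the block: `K · (form of hzInt) − K c ‖w‖² ≥ 0`
  have hexp : (∑ i, ∑ j, (starRingEnd ℂ) (w i) * (blockA a b TN TD UU C.K C.c L i j : ℂ) * w j).re =
      (C.K : ℝ) * (∑ i : Fin n, ∑ j : Fin n, (starRingEnd ℂ) (w i) * (hzInt a b TN TD UU L[i] L[j] : ℂ) * w j).re
        - (C.K : ℝ) * C.c * ∑ i : Fin n, ‖w i‖ ^ 2 := by
    have hpt : ∀ i j : Fin n, (starRingEnd ℂ) (w i) * (blockA a b TN TD UU C.K C.c L i j : ℂ) * w j =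
        ((C.K : ℝ) : ℂ) * ((starRingEnd ℂ) (w i) * (hzInt a b TN TD UU L[i] L[j] : ℂ) * w j)
          - ((C.K : ℝ) : ℂ) * (C.c : ℂ) * ((starRingEnd ℂ) (w i) * (if i = j then 1 else 0) * w j) := by
      intro i j
      simp only [blockA, Int.cast_mul, Int.cast_sub, Int.cast_natCast, Int.cast_ite, Int.cast_zero]
      push_cast
      split_ifs <;> ring
    simp_rw [hpt]
    rw [Finset.sum_congr rfl fun i _ => Finset.sum_sub_distrib _ _, Finset.sum_sub_distrib]
    simp_rw [← Finset.mul_sum]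
    have hdiag : (∑ i : Fin n, ∑ j : Fin n, (starRingEnd ℂ) (w i) * (if i = j then (1 : ℂ) else 0) * w j) =
        ((∑ i : Fin n, ‖w i‖ ^ 2 : ℝ) : ℂ) := by
      push_cast
      refine Finset.sum_congr rfl fun i _ => ?_
      rw [Finset.sum_eq_single i (fun j _ hj => by simp [Ne.symm hj]) (by simp), if_pos rfl, mul_one,
        mul_comm, Complex.mul_conj, Complex.normSq_eq_norm_sq]
      norm_cast
    rw [hdiag, Complex.sub_re, Complex.re_ofReal_mul, ← Complex.ofReal_intCast, ← Complex.ofReal_mul,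
      ← Complex.ofReal_mul, Complex.ofReal_re]
  rw [hexp] at hA
  have hK' : (0 : ℝ) < (C.K : ℝ) := by exact_mod_cast hK
  rw [hvv_re, hvHv_re, floor]
  have hcast : ((((C.c : ℚ) / (Q : ℚ)) : ℚ) : ℝ) = (C.c : ℝ) / (Q : ℝ) := by push_cast; ring
  rw [hcast, div_mul_eq_mul_div, div_le_div_iff_of_pos_right hQpos]
  nlinarith [hA, hK']

end KCert

/-! ### §4 From sector certificates to `N`-sector floors -/

section Assembly

/-- **Certificate form.** For the open `a × b` cluster with couplings `(TN/Q, TD/Q, UU/Q)` and a particle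
number `k ≤ 2ab`: if for every `p ≤ k` a data-free certificate `certs p` with the supplied code list
`Ls p` of the spin sector `(p, k − p)` passes the kernel checker and its floor is `≥ σ`, then
`σ ≤ E₀(h^open_{a×b}, k)` — the hypothesis of the Anderson cluster bounds.
[cite: KullEtAl2024, §5.3] [cite: Anderson1951, eq. (2)] -/
theorem groundEnergy_ge_of_kCerts (a b : ℕ) (TN TD UU : ℤ) (Q : ℕ) {k : ℕ} (hk : k ≤ 2 * (a * b))
    (σ : ℚ) (Ls : ℕ → List ℕ) (certs : ℕ → KCert)
    (hcheck : ∀ p ≤ k, (certs p).check a b p (k - p) TN TD UU Q (Ls p) = true)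
    (hσ : ∀ p ≤ k, σ ≤ (certs p).floor Q) :
    (σ : ℝ) ≤ groundEnergy (hubbardOpenBoxTT' a b ((TN : ℝ) / Q) ((TD : ℝ) / Q) ((UU : ℝ) / Q)) k := by
  have hc : Fintype.card (Orb (Fin a ×ₗ Fin b)) = a * b * 2 := by
    simp [Fintype.card_prod, Fintype.card_lex, Fintype.card_fin]
  have hcard : k ≤ Fintype.card (Orb (Fin a ×ₗ Fin b)) := by rw [hc]; omega
  refine le_groundEnergy_of_spinSectorFloors _ (ThermodynamicLimit.preservesSectors_hubbardOpenBoxTT' a b _ _ _)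
    hcard σ ?_
  intro p q hpq v hv
  have hp : p ≤ k := by omega
  have hq : q = k - p := by omega
  subst hq
  have hs := (certs p).sound (hcheck p hp) v hv
  have hfl : (σ : ℝ) ≤ (((certs p).floor Q : ℚ) : ℝ) := by exact_mod_cast hσ p hp
  have hnn : 0 ≤ (star v ⬝ᵥ v).re := by
    rw [dotProduct, Complex.re_sum]
    exact Finset.sum_nonneg fun s _ => by
      rw [Pi.star_apply, mul_comm, RCLike.star_def, Complex.mul_conj]; simp [Complex.normSq_nonneg]
  exact le_trans (mul_le_mul_of_nonneg_right hfl hnn) hs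

end Assembly

end Sound

end OccupationCode

end Literature.MathematicalPhysics.QuantumLattice
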